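import Literature.NumberTheory.Automorphic.UnitaryGroupKernelBorelClassUnipotentTwo
import Literature.NumberTheory.Automorphic.UnitaryGroupTruncatedKernelMeasurableTwo
import HarnessLib

/-!
# Arthur's truncated class kernel of `U(J₂)` at the central class `z · 𝒰(F)`:
# `k^T_𝔬(x) = f(z₁) + Σ_{δ ∈ B(F)∖G(F)} [Σ_{u ∈ N(F), u ≠ 1} f(x⁻¹δ⁻¹ z₁ u δx) − 1_{H(δx) > T} ν(𝓕)⁻¹ ∫_{N(𝔸)} f(x⁻¹δ⁻¹ z₁ n δx) dn]`
(Rogawski, *Automorphic Representations of Unitary Groups in Three Variables* (1990), §7.3 Prop. 7.3.1 (pp. 97–98): the unipotent term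
of `U(2)` «as in the previous section»; here the integrand, as a coset sum over `B(F)∖G(F)` BEFORE the unfolding, the `N = 2` twin of ★
`UnitaryGroupTruncatedKernelClassUnipotent` (B0 FILE 5 of the `U(3)` LAW 5 road).)

Topic `NumberTheory/Automorphic`; namespace `Literature.NumberTheory.Automorphic.UnitaryGroup`. THEOREMS ONLY over accepted tree modules
(no definition, no named fact, no instance, no notation, no `sorry`). H-side row (σ-u) «`TruncatedKernelClassUnipotentTwo`» of
`CENSUS-LAWS-Hside` (cell `pub/hodgecm-mathlib`, crux H413, `Cruxes/H413/Lines/F0_T1InnerFormTraceIdentity.lean`), over ★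
`UnitaryGroupKernelClassUnipotentTwo` (`K_𝔬(x,x)`, the `_fin` central-class letters) and ★ `UnitaryGroupKernelBorelClassUnipotentTwo`
(`K_{B,𝔬}`, F0P3a-p04). Letters: `z ∈ E¹` as `ζ : ratOne F E c`, `z₁ ∈ G(F)` with `↑z₁ = toAdelic (z·1)`, a class map `cl` whose fibre at `i`
is `{charpoly = (X − z)² ⊗ 𝔸_E}` and which is constant along `N(F)` on `B(F)` (`IsUnipotentInvariantOnBorel`), `q̃ = Quotient.out q`.

* §1 **`exists_equiv_borelQuotient_prod_central_two`** — THE BIJECTION `(B(F)δ, u) ↦ δ⁻¹ z₁ u δ` of `(B(F)∖G(F)) × (N(F) ∖ 1)` onto `𝔬 ∖ {z₁}`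
  as an `Equiv` (surjective by ★ `forall_exists_conj_mem_arithmeticBorel_of_charpoly_eq_sq_two`, injective by ★
  `mem_arithmeticBorel_of_conj_mem_of_conj_mem_two`), with the summability letters `summable_prod_central_two` ∕ `summable_tsum_central_two`.
* §2 **`truncatedKernelClass_eq_add_tsum_central_two`** — for `f ∈ C_c(G(𝔸_F))`, `T > 0`, a Haar measure `ν` of `N(𝔸_F)` and a fundamental domain
  `𝓕` of `N(F)`: `k^T_𝔬(x) = f(z₁) + Σ'_{q} [Σ'_{u ≠ 1} f(x⁻¹ q̃⁻¹ z₁ u q̃ x) − 1_{T < H(q̃x)} · ν(𝓕)⁻¹ ∫_{N(𝔸_F)} f(x⁻¹ q̃⁻¹ z₁ m q̃ x) dν(m)]`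
  — ★ `kernelClass_diag_eq_add_tsum_central_two` minus the finite `δ`-sum of class tails (★ `finite_support_kernelBorelTailClass_translate_two`) read
  through ★ `kernelBorelClass_eq_smul_integral_central_two`. At `N = 2`, `N(F) ≅ E⁻` and `N(𝔸_F) ≅ 𝔸_E⁻` are the centre LINE (★ H-B1a
  `UnitaryGroupLineUnipotentTwo`): the inner sum and integral are the line sum ∕ line integral of Prop. 7.3.1.

## References

* J. D. Rogawski, *Automorphic Representations of Unitary Groups in Three Variables*, Annals of Mathematics Studies 123 (1990), §2.2 (p. 13),
  Prop. 7.2.1 (pp. 91–92), §7.3 Prop. 7.3.1 (pp. 97–98) [Rogawski1990].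
* J. Arthur, *A trace formula for reductive groups I*, Duke Math. J. 45 (1978), §8 [Arthur1978TraceFormulaI].
-/

set_option autoImplicit false

noncomputable section

open NumberField IsDedekindDomain Matrix Polynomial MeasureTheory
open scoped MatrixGroups NNReal

namespace Literature.NumberTheory.Automorphic

namespace UnitaryGroup

variable {F E : Type} [Field F] [NumberField F] [Field E] [NumberField E] [Algebra F E]
  {c : E ≃ₐ[F] E} {ι : Type*}

variable (ζ : ratOne F E c) {z₁ : (quasiSplit F E c 2).arithmeticSubgroup}

/-! ## §1 The bijection `(B(F)\G(F)) × (N(F) ∖ 1) ≃ 𝔬 ∖ {z₁}` and its summability letters -/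

/-- **THE BIJECTION `(B(F)δ, u) ↦ δ⁻¹ z₁ u δ` OF `(B(F)\G(F)) × (N(F) ∖ 1)` ONTO `𝔬 ∖ {z₁}`** (`δ = q̃`): every
element of the class `(X − z)²` other than `z₁` lies in exactly one rational Borel `q̃⁻¹ B(F) q̃`, and
`B(F) ∩ 𝔬 = z₁ · N(F)` — [Rogawski1990, proof of Prop. 7.2.1]: «`γ′ = δ⁻¹nγδ` … `δ` is unique modulo `B_γ`».
(Surjective: ★ `forall_exists_conj_mem_arithmeticBorel_of_charpoly_eq_pow_three` + ★
`inv_mul_mem_adelicUnipotent_of_charpoly_eq_fin`; injective: ★ `mem_arithmeticBorel_of_conj_mem_of_conj_mem`.)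
[cite: Rogawski1990, Prop. 7.2.1 (pp. 91–92)] -/
theorem exists_equiv_borelQuotient_prod_central_two {cl : (quasiSplit F E c 2).arithmeticSubgroup → ι}
    (hz₁ : (z₁ : (quasiSplit F E c 2).Adelic) =
      (quasiSplit F E c 2).toAdelic (ratCenter F E c 2 ((StdForm.antidiagonal 2).over E) ζ))
    {i : ι} (hcl : ∀ γ : (quasiSplit F E c 2).arithmeticSubgroup, cl γ = i ↔
      ((adelicVal F E c 2 _ (γ : (quasiSplit F E c 2).Adelic) : GL (Fin 2) (AdeleRing (𝓞 E) E)) :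
          Matrix (Fin 2) (Fin 2) (AdeleRing (𝓞 E) E)).charpoly =
        ((X - C ((ζ : Eˣ) : E)) ^ 2).map (algebraMap E (AdeleRing (𝓞 E) E))) :
    ∃ e : (Quotient (QuotientGroup.rightRel (arithmeticBorel F E c 2)) × {u : rationalUnipotent F E c 2 // u ≠ 1}) ≃
        {γ : ↥(cl ⁻¹' {i}) // ((γ : ↥(cl ⁻¹' {i})) : (quasiSplit F E c 2).arithmeticSubgroup) ≠ z₁},
      ∀ p, ((((e p) : ↥(cl ⁻¹' {i})) : ↥(cl ⁻¹' {i})) : (quasiSplit F E c 2).arithmeticSubgroup) =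
        p.1.out⁻¹ * (z₁ * ⟨(((p.2.1 : rationalUnipotent F E c 2) : adelicUnipotent F E c 2) :
          (quasiSplit F E c 2).Adelic), (p.2.1 : rationalUnipotent F E c 2).2⟩) * p.1.out := by
  classical
  have hz := conj_mul_self_of_ratOne ζ
  set Γq := Quotient (QuotientGroup.rightRel (arithmeticBorel F E c 2)) with hΓq
  set uG : {u : rationalUnipotent F E c 2 // u ≠ 1} → (quasiSplit F E c 2).arithmeticSubgroup := fun u =>
    ⟨(((u.1 : rationalUnipotent F E c 2) : adelicUnipotent F E c 2) : (quasiSplit F E c 2).Adelic),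
      (u.1 : rationalUnipotent F E c 2).2⟩ with huG
  have huGN : ∀ u, ((uG u : (quasiSplit F E c 2).arithmeticSubgroup) : (quasiSplit F E c 2).Adelic) ∈
      adelicUnipotent F E c 2 := fun u => ((u.1 : rationalUnipotent F E c 2) : adelicUnipotent F E c 2).2
  have huG1 : ∀ u, uG u ≠ 1 := by
    intro u h
    apply u.2
    have h' := congrArg (fun γ : (quasiSplit F E c 2).arithmeticSubgroup => (γ : (quasiSplit F E c 2).Adelic)) h
    exact Subtype.ext (Subtype.ext h')
  have hz₁B := mem_arithmeticBorel_of_coe_eq_toAdelic_ratCenter_fin ζ hz₁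
  have hmem : ∀ (q : Γq) (u : {u : rationalUnipotent F E c 2 // u ≠ 1}),
      cl (q.out⁻¹ * (z₁ * uG u) * q.out) = i := fun q u => by
    rw [hcl, charpoly_adelicVal_inv_mul_mul_fin]
    exact charpoly_mul_eq_of_mem_adelicUnipotent_fin ζ hz₁ (huGN u)
  have hne : ∀ (q : Γq) (u : {u : rationalUnipotent F E c 2 // u ≠ 1}),
      q.out⁻¹ * (z₁ * uG u) * q.out ≠ z₁ := by
    intro q u h
    apply huG1 u
    have h2 : z₁ * uG u = q.out * z₁ * q.out⁻¹ := by
      calc z₁ * uG u = q.out * (q.out⁻¹ * (z₁ * uG u) * q.out) * q.out⁻¹ := by group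
        _ = q.out * z₁ * q.out⁻¹ := by rw [h]
    rw [← mul_comm_of_coe_eq_toAdelic_ratCenter_fin ζ hz₁ q.out, mul_assoc, mul_inv_cancel, mul_one] at h2
    exact mul_left_cancel (h2.trans (mul_one z₁).symm)
  set Φ : Γq × {u : rationalUnipotent F E c 2 // u ≠ 1} →
      {γ : ↥(cl ⁻¹' {i}) // ((γ : ↥(cl ⁻¹' {i})) : (quasiSplit F E c 2).arithmeticSubgroup) ≠ z₁} := fun p =>
    ⟨⟨p.1.out⁻¹ * (z₁ * uG p.2) * p.1.out, hmem p.1 p.2⟩, hne p.1 p.2⟩ with hΦ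
  have hΦinj : Function.Injective Φ := by
    rintro ⟨q₁, u₁⟩ ⟨q₂, u₂⟩ h
    have hγ : q₁.out⁻¹ * (z₁ * uG u₁) * q₁.out = q₂.out⁻¹ * (z₁ * uG u₂) * q₂.out :=
      congrArg (fun t => ((t.1 : ↥(cl ⁻¹' {i})) : (quasiSplit F E c 2).arithmeticSubgroup)) h
    set γ := q₁.out⁻¹ * (z₁ * uG u₁) * q₁.out with hγdef
    have h₁ : q₁.out * γ * q₁.out⁻¹ ∈ arithmeticBorel F E c 2 := by
      have : q₁.out * γ * q₁.out⁻¹ = z₁ * uG u₁ := by rw [hγdef]; group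
      rw [this]
      exact mul_mem hz₁B (mem_arithmeticBorel_of_mem_adelicUnipotent (huGN u₁))
    have h₂ : q₂.out * γ * q₂.out⁻¹ ∈ arithmeticBorel F E c 2 := by
      have : q₂.out * γ * q₂.out⁻¹ = z₁ * uG u₂ := by rw [hγ]; group
      rw [this]
      exact mul_mem hz₁B (mem_arithmeticBorel_of_mem_adelicUnipotent (huGN u₂))
    have hcharγ := (hcl γ).1 (hmem q₁ u₁)
    have hneγ : ((adelicVal F E c 2 _ (γ : (quasiSplit F E c 2).Adelic) : GL (Fin 2) (AdeleRing (𝓞 E) E)) :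
        Matrix (Fin 2) (Fin 2) (AdeleRing (𝓞 E) E)) ≠
        algebraMap E (AdeleRing (𝓞 E) E) ((ζ : Eˣ) : E) • (1 : Matrix (Fin 2) (Fin 2) (AdeleRing (𝓞 E) E)) :=
      fun h => hne q₁ u₁ (eq_of_coe_adelicVal_eq_smul_one_fin ζ hz₁ h)
    have hq : q₁ = q₂ := by
      rw [← Quotient.out_eq q₁, ← Quotient.out_eq q₂]
      exact Quotient.sound (QuotientGroup.rightRel_apply.2
        (mem_arithmeticBorel_of_conj_mem_of_conj_mem_two hcharγ hneγ h₁ h₂))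
    subst hq
    have hu : uG u₁ = uG u₂ := by
      have h3 : z₁ * uG u₁ = z₁ * uG u₂ := by
        have := hγ
        rw [hγdef] at this
        simpa [mul_assoc] using this
      exact mul_left_cancel h3
    have hu' : u₁ = u₂ := by
      have h' := congrArg (fun γ : (quasiSplit F E c 2).arithmeticSubgroup => (γ : (quasiSplit F E c 2).Adelic)) hu
      exact Subtype.ext (Subtype.ext (Subtype.ext h'))
    rw [hu']
  have hΦsurj : Function.Surjective Φ := by
    rintro ⟨⟨γ, hγi⟩, hγne⟩
    have hcharγ := (hcl γ).1 hγi
    obtain ⟨δ, hδ⟩ := forall_exists_conj_mem_arithmeticBorel_of_charpoly_eq_sq_two hz γ hcharγ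
    set q : Γq := Quotient.mk _ δ with hq
    have hrel : δ * q.out⁻¹ ∈ arithmeticBorel F E c 2 :=
      QuotientGroup.rightRel_apply.1 (Quotient.exact (by rw [hq, Quotient.out_eq]))
    set β := q.out * γ * q.out⁻¹ with hβ
    have hβB : β ∈ arithmeticBorel F E c 2 := by
      have : β = (δ * q.out⁻¹)⁻¹ * (δ * γ * δ⁻¹) * (δ * q.out⁻¹) := by rw [hβ]; group
      rw [this]
      exact mul_mem (mul_mem (inv_mem hrel) hδ) hrel
    have hcharβ : ((adelicVal F E c 2 _ (β : (quasiSplit F E c 2).Adelic) : GL (Fin 2) (AdeleRing (𝓞 E) E)) :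
        Matrix (Fin 2) (Fin 2) (AdeleRing (𝓞 E) E)).charpoly =
        ((X - C ((ζ : Eˣ) : E)) ^ 2).map (algebraMap E (AdeleRing (𝓞 E) E)) := by
      rw [hβ, charpoly_adelicVal_mul_mul_inv_fin]; exact hcharγ
    have huN := inv_mul_mem_adelicUnipotent_of_charpoly_eq_fin ζ hz₁ hβB hcharβ
    set u₀ : rationalUnipotent F E c 2 :=
      ⟨⟨((z₁⁻¹ * β : (quasiSplit F E c 2).arithmeticSubgroup) : (quasiSplit F E c 2).Adelic), huN⟩,
        (z₁⁻¹ * β : (quasiSplit F E c 2).arithmeticSubgroup).2⟩ with hu₀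
    have hu₀1 : u₀ ≠ 1 := by
      intro h
      apply hγne
      have h' : ((z₁⁻¹ * β : (quasiSplit F E c 2).arithmeticSubgroup) : (quasiSplit F E c 2).Adelic) = 1 :=
        congrArg (fun v : rationalUnipotent F E c 2 => (((v : adelicUnipotent F E c 2)) : (quasiSplit F E c 2).Adelic)) h
      have h'' : z₁⁻¹ * β = 1 := Subtype.ext h'
      have hβz : β = z₁ := by
        rw [← mul_one z₁, ← h'']; group
      change γ = z₁
      have : γ = q.out⁻¹ * β * q.out := by rw [hβ]; group
      rw [this, hβz, mul_assoc, mul_comm_of_coe_eq_toAdelic_ratCenter_fin ζ hz₁ q.out, inv_mul_cancel_left]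
    refine ⟨(q, ⟨u₀, hu₀1⟩), Subtype.ext (Subtype.ext ?_)⟩
    change q.out⁻¹ * (z₁ * uG ⟨u₀, hu₀1⟩) * q.out = γ
    have : uG ⟨u₀, hu₀1⟩ = z₁⁻¹ * β := Subtype.ext rfl
    rw [this, mul_inv_cancel_left, hβ]
    group
  exact ⟨Equiv.ofBijective Φ ⟨hΦinj, hΦsurj⟩, fun p => rfl⟩

/-- **Summability letter**: if the class sum `Σ'_{γ ∈ 𝔬} f(x⁻¹ γ x)` is summable, so is the regrouped family
`(q, u) ↦ f(x⁻¹ q̃⁻¹ z₁ u q̃ x)` on `(B(F)\G(F)) × (N(F) ∖ 1)`. [cite: Rogawski1990, Prop. 7.2.1 (pp. 91–92)] -/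
theorem summable_prod_central_two {cl : (quasiSplit F E c 2).arithmeticSubgroup → ι}
    (hz₁ : (z₁ : (quasiSplit F E c 2).Adelic) =
      (quasiSplit F E c 2).toAdelic (ratCenter F E c 2 ((StdForm.antidiagonal 2).over E) ζ))
    {i : ι} (hcl : ∀ γ : (quasiSplit F E c 2).arithmeticSubgroup, cl γ = i ↔
      ((adelicVal F E c 2 _ (γ : (quasiSplit F E c 2).Adelic) : GL (Fin 2) (AdeleRing (𝓞 E) E)) :
          Matrix (Fin 2) (Fin 2) (AdeleRing (𝓞 E) E)).charpoly =
        ((X - C ((ζ : Eˣ) : E)) ^ 2).map (algebraMap E (AdeleRing (𝓞 E) E)))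
    (f : (quasiSplit F E c 2).Adelic → ℂ) (x : (quasiSplit F E c 2).Adelic)
    (hsum : Summable fun γ : cl ⁻¹' {i} =>
      f (x⁻¹ * (((γ : cl ⁻¹' {i}) : (quasiSplit F E c 2).arithmeticSubgroup) : (quasiSplit F E c 2).Adelic) * x)) :
    Summable fun p : Quotient (QuotientGroup.rightRel (arithmeticBorel F E c 2)) ×
        {u : rationalUnipotent F E c 2 // u ≠ 1} =>
      f (x⁻¹ * (((p.1.out⁻¹ * (z₁ * ⟨(((p.2.1 : rationalUnipotent F E c 2) : adelicUnipotent F E c 2) :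
          (quasiSplit F E c 2).Adelic), (p.2.1 : rationalUnipotent F E c 2).2⟩) * p.1.out :
        (quasiSplit F E c 2).arithmeticSubgroup)) : (quasiSplit F E c 2).Adelic) * x) := by
  obtain ⟨e, he⟩ := exists_equiv_borelQuotient_prod_central_two ζ hz₁ hcl
  have h := (hsum.subtype {γ : ↥(cl ⁻¹' {i}) |
    ((γ : ↥(cl ⁻¹' {i})) : (quasiSplit F E c 2).arithmeticSubgroup) ≠ z₁}).comp_injective e.injective
  refine h.congr fun p => ?_
  simp only [Function.comp_apply]
  rw [← he p]

/-- **Summability letter, fibred**: the `u`-sums `q ↦ Σ'_{u ≠ 1} f(x⁻¹ q̃⁻¹ z₁ u q̃ x)` form a summable family on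
`B(F)\G(F)` (Mathlib `Summable.prod`). [cite: Rogawski1990, Prop. 7.2.1 (pp. 91–92)] -/
theorem summable_tsum_central_two {cl : (quasiSplit F E c 2).arithmeticSubgroup → ι}
    (hz₁ : (z₁ : (quasiSplit F E c 2).Adelic) =
      (quasiSplit F E c 2).toAdelic (ratCenter F E c 2 ((StdForm.antidiagonal 2).over E) ζ))
    {i : ι} (hcl : ∀ γ : (quasiSplit F E c 2).arithmeticSubgroup, cl γ = i ↔
      ((adelicVal F E c 2 _ (γ : (quasiSplit F E c 2).Adelic) : GL (Fin 2) (AdeleRing (𝓞 E) E)) :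
          Matrix (Fin 2) (Fin 2) (AdeleRing (𝓞 E) E)).charpoly =
        ((X - C ((ζ : Eˣ) : E)) ^ 2).map (algebraMap E (AdeleRing (𝓞 E) E)))
    (f : (quasiSplit F E c 2).Adelic → ℂ) (x : (quasiSplit F E c 2).Adelic)
    (hsum : Summable fun γ : cl ⁻¹' {i} =>
      f (x⁻¹ * (((γ : cl ⁻¹' {i}) : (quasiSplit F E c 2).arithmeticSubgroup) : (quasiSplit F E c 2).Adelic) * x)) :
    Summable fun q : Quotient (QuotientGroup.rightRel (arithmeticBorel F E c 2)) =>
      ∑' u : {u : rationalUnipotent F E c 2 // u ≠ 1},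
        f (x⁻¹ * (((q.out⁻¹ * (z₁ * ⟨(((u.1 : rationalUnipotent F E c 2) : adelicUnipotent F E c 2) :
            (quasiSplit F E c 2).Adelic), (u.1 : rationalUnipotent F E c 2).2⟩) * q.out :
          (quasiSplit F E c 2).arithmeticSubgroup)) : (quasiSplit F E c 2).Adelic) * x) :=
  (summable_prod_central_two ζ hz₁ hcl f x hsum).prod

/-! ## §2 `k^T_𝔬(x)` at the central class -/

section Truncated

variable [MeasurableSpace (adelicUnipotent F E c 2)] [BorelSpace (adelicUnipotent F E c 2)]

/-- **ARTHUR'S TRUNCATED CLASS KERNEL AT THE CENTRAL CLASS `z · 𝒰(F)`**: for `f ∈ C_c(G(𝔸_F))`, `T > 0`, a Haar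
measure `ν` of `N(𝔸_F)`, a fundamental domain `𝓕` of `N(F)`, a class map `cl` constant along `N(F)` on `B(F)` whose
fibre at `i` is `{charpoly = (X − z)² ⊗ 𝔸_E}`, and every `x` at which the class sum is summable,
`k^T_𝔬(x) = f(z₁) + Σ'_{q ∈ B(F)\G(F)} [Σ'_{u ∈ N(F), u ≠ 1} f(x⁻¹ q̃⁻¹ z₁ u q̃ x)
  − 1_{T < H(q̃ x)} · ν(𝓕)⁻¹ ∫_{N(𝔸_F)} f(x⁻¹ q̃⁻¹ z₁ m q̃ x) dν(m)]`
— the bracket `Σ_{u ∈ N, u ≠ 1} f(g⁻¹γug) − τ(H(g) − T)∫_𝐍 f(g⁻¹γng) dn` of [Rogawski1990, §7.3 p. 95] at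
`g = q̃ x`, summed over the cosets `B(F)q̃` (tree: `k^T_𝔬 = K_𝔬(x,x) − Σ_δ 1_{H(δx)>T} K_{B,𝔬}(δx,δx)`, the
`δ`-sum finite ★ `finite_support_kernelBorelTailClass_translate`; `K_𝔬(x,x)` ★
`kernelClass_diag_eq_add_tsum_central`; `K_{B,𝔬}` ★ `kernelBorelClass_eq_smul_integral_central`).
[cite: Rogawski1990, §7.3 (p. 95)] [cite: Rogawski1990, §2.2 (p. 13)] -/
theorem truncatedKernelClass_eq_add_tsum_central_two {cl : (quasiSplit F E c 2).arithmeticSubgroup → ι}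
    (hz₁ : (z₁ : (quasiSplit F E c 2).Adelic) =
      (quasiSplit F E c 2).toAdelic (ratCenter F E c 2 ((StdForm.antidiagonal 2).over E) ζ))
    {i : ι} (hcl : ∀ γ : (quasiSplit F E c 2).arithmeticSubgroup, cl γ = i ↔
      ((adelicVal F E c 2 _ (γ : (quasiSplit F E c 2).Adelic) : GL (Fin 2) (AdeleRing (𝓞 E) E)) :
          Matrix (Fin 2) (Fin 2) (AdeleRing (𝓞 E) E)).charpoly =
        ((X - C ((ζ : Eˣ) : E)) ^ 2).map (algebraMap E (AdeleRing (𝓞 E) E)))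
    (hclN : IsUnipotentInvariantOnBorel F E c 2 cl)
    (ν : Measure (adelicUnipotent F E c 2)) [ν.IsHaarMeasure]
    {𝓕 : Set (adelicUnipotent F E c 2)} (h𝓕 : IsFundamentalDomain (rationalUnipotent F E c 2) 𝓕 ν)
    {T : ℝ≥0} (hT : 0 < T) {f : (quasiSplit F E c 2).Adelic → ℂ} (hfc : Continuous f) (hf : HasCompactSupport f)
    (x : (quasiSplit F E c 2).Adelic)
    (hsum : Summable fun γ : cl ⁻¹' {i} =>
      f (x⁻¹ * (((γ : cl ⁻¹' {i}) : (quasiSplit F E c 2).arithmeticSubgroup) : (quasiSplit F E c 2).Adelic) * x)) :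
    truncatedKernelClass ν 𝓕 T cl i f x = f (z₁ : (quasiSplit F E c 2).Adelic) +
      ∑' q : Quotient (QuotientGroup.rightRel (arithmeticBorel F E c 2)),
        ((∑' u : {u : rationalUnipotent F E c 2 // u ≠ 1},
          f (x⁻¹ * (((q.out⁻¹ * (z₁ * ⟨(((u.1 : rationalUnipotent F E c 2) : adelicUnipotent F E c 2) :
              (quasiSplit F E c 2).Adelic), (u.1 : rationalUnipotent F E c 2).2⟩) * q.out :
            (quasiSplit F E c 2).arithmeticSubgroup)) : (quasiSplit F E c 2).Adelic) * x)) -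
        Set.indicator {y : (quasiSplit F E c 2).Adelic | T < borelHeight y}
          (fun y => ((ν 𝓕).toReal⁻¹ : ℝ) • ∫ m : adelicUnipotent F E c 2,
            f (y⁻¹ * (z₁ : (quasiSplit F E c 2).Adelic) * ((m : adelicUnipotent F E c 2) : (quasiSplit F E c 2).Adelic) * y) ∂ν)
          (((q.out : (quasiSplit F E c 2).arithmeticSubgroup) : (quasiSplit F E c 2).Adelic) * x)) := by
  have hA := summable_tsum_central_two ζ hz₁ hcl f x hsum
  have hfin := finite_support_kernelBorelTailClass_translate_two ν 𝓕 hT cl i f x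
  have hB : Summable fun q : Quotient (QuotientGroup.rightRel (arithmeticBorel F E c 2)) =>
      kernelBorelTailClass ν 𝓕 T cl i f
        (((q.out : (quasiSplit F E c 2).arithmeticSubgroup) : (quasiSplit F E c 2).Adelic) * x) :=
    summable_of_ne_finset_zero (s := hfin.toFinset) fun q hq =>
      Function.notMem_support.1 fun h => hq (hfin.mem_toFinset.2 h)
  have hfs : (∑ᶠ q : Quotient (QuotientGroup.rightRel (arithmeticBorel F E c 2)),
      kernelBorelTailClass ν 𝓕 T cl i f
        (((q.out : (quasiSplit F E c 2).arithmeticSubgroup) : (quasiSplit F E c 2).Adelic) * x)) =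
      ∑' q : Quotient (QuotientGroup.rightRel (arithmeticBorel F E c 2)),
        kernelBorelTailClass ν 𝓕 T cl i f
          (((q.out : (quasiSplit F E c 2).arithmeticSubgroup) : (quasiSplit F E c 2).Adelic) * x) :=
    (tsum_eq_finsum hfin).symm
  rw [truncatedKernelClass_def, kernelClass_diag_eq_add_tsum_central_two ζ hz₁ hcl f x hsum, pseudoEisenstein_def,
    hfs, add_sub_assoc, ← Summable.tsum_sub hA hB]
  congr 1
  refine tsum_congr fun q => ?_
  congr 1
  -- the class tail at `y = q̃ x`
  set y : (quasiSplit F E c 2).Adelic :=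
    ((q.out : (quasiSplit F E c 2).arithmeticSubgroup) : (quasiSplit F E c 2).Adelic) * x with hy
  by_cases hlt : T < borelHeight y
  · rw [kernelBorelTailClass_of_lt cl i f hlt, Set.indicator_of_mem (show y ∈ {y | T < borelHeight y} from hlt),
      kernelBorelClass_eq_smul_integral_central_two ν h𝓕 hclN ζ hcl hfc hf y y, hz₁]
  · rw [kernelBorelTailClass_of_not_lt cl i f hlt,
      Set.indicator_of_notMem (show y ∉ {y | T < borelHeight y} from hlt)]

end Truncated

end UnitaryGroup

end Literature.NumberTheory.Automorphic
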